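import Summits.KontsevichZagierPeriods.Zeta5Search.RVLargeParamVFloor
import Summits.KontsevichZagierPeriods.Zeta5Search.RVLargeParamVULayer
import Summits.KontsevichZagierPeriods.Zeta5Search.CellKitAssembly
import Summits.KontsevichZagierPeriods.Zeta5Search.CellKitRays
import HarnessLib

/-!
# RVLargeParamVCases — the constant-term floor (V⁺) PROVED in the counting, palindromic and U-layer cases; the residual node (fam-rv gen 9, file 3)

HONEST FRAMING: systematic search; no irrationality claim unless certified.  This file MINTS ONE CONJECTURE NODE
(`LargeParamVResidual`, `@[conjecture]`, found by exact computation in this cell — NOT a published result, used only as an explicit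
hypothesis) and PROVES `LargeParamVResidual → LargeParamVFloor` (gen 9 file 1's node (V⁺)), hence `→ LargeParamClassLaw` (gen 8's
(CV⁺)) and `→ FlatGaugeLawF1` (the flat `S₇`-gauge law on {at most one long block, `b₀ < 3p`}).  `p`-adic valuations of rational
numbers only; no γ / measure claim; nothing about irrationality.

THE SPLIT.  (V⁺) asks `v_p V(c) ≥ t := −N_p(b) + δ(b,p)` for `c ∈ {b, b + e_j}`.  Three decidable tests, each with a PROVED bound:
* COUNTING (`countingCase`, `val_ge_of_counting`): every pole class has `ν_x ≥ t` — termwise, `classNuBound`;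
* PALINDROMIC ZERO CELL (`palCase`, `val_ge_of_pal`): `m = t − 1` even, `m ≤ E_x` everywhere, every class of exponent `m`
  centre-free of palindromic level type — the CELL KIT (`CellKit.zero_bound_WV` with `CellKit.pair_zero_of_pal`: the first digits
  of conjugate classes cancel in pairs);
* U-LAYER (`ClusterValuation.uLayerCase`, `ClusterValuation.val_ge_of_uLayer`, file `RVLargeParamVULayer.lean`): level-one layer
  expansion, top layer killed by reflection, next layer `≡ U(c) ≡ 0 (mod p)` by THEOREM C.
CENSUS (exact; `pub-zeta5-fam-rv/gen9/rv9_pal.py`, `rv9_ulayer.py`, outputs `gen9/out/pal_6_19.json`, `ulayer_6_19.json`,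
`ulayer_20_22.json`) over all pairs `(c,p)`, `c ∈ {b, b+e_j}`, of deep one-long-block instances (`5 ≤ p ≤ m₁(b)`):
`b₀ ≤ 19`: 77,272 pairs = 76,310 counting + 857 palindromic + 71 U-layer + 34 RESIDUAL; `b₀ ≤ 22`: 266,605 pairs =
264,661 + 1,656 + 189 + 99 RESIDUAL.  The residual pairs (31 of the 34 at `δ = 2`) are level-one configurations in which a ZERO
is adjacent to a sextic pole (level types `(1,−6,0)/(0,−6,1)`: the partner's first layer is removed by the evaluation identity at
the zero, `ZeroEvaluation`, instead of by symmetry), or a deficient quintic pole has a level-zero mirror (types `(−5,0)/(0,−5)`),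
or a pole sits at level two; (V⁺) holds in all of them (0 failures, certificate `rv9_vplus_cert.py`, 51,992 instances `b₀ ≤ 22`).
-/

noncomputable section

open Finset

namespace Summit.KontsevichZagierPeriods.Zeta5Search.RVFlatGauge

open Summit.KontsevichZagierPeriods.Zeta5Search.CasoratianValuation (casoratian shift InPolytope pairFloors refund)
open Summit.KontsevichZagierPeriods.Zeta5Search.WedgeDictionary (coeffV dOf)
open Summit.KontsevichZagierPeriods.Zeta5Search.ClusterValuation (constantTermFloorLaw_window pairFloors_shift_le)
open Cap

/-! ### The split of (V⁺): COUNTING classes (proved) ∪ PALINDROMIC zero cells (proved) ∪ a residual node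

Per parameter vector `c ∈ {b, b + e_j}` and target `t = −N_p(b) + δ(b,p)`:
* COUNTING CASE (`countingCase c p t`): every pole class has `ν_x ≥ t` (`ν_x` = `classNu`: `E_x`, or `max(E_x,0)` for a tame
  single-pole class).  Then `v_p V(c) ≥ t` termwise, by `classNuBound` (`padicNorm_coeffV_le`).  PROVED (`val_ge_of_counting`).
* PALINDROMIC CASE (`palCase c p (t−1)`): `m := t − 1` is `≤ −4`, even, `≤ E_x` for every class, `p ≤ c₀`, and every class with
  `E_x = m` is centre-free with a PALINDROMIC level type (net exponents along `x, x+p, x+2p, …` read the same backwards).  Then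
  the pair vectors of the level-`m` classes vanish (`CellKit.pair_zero_of_pal`) and the CELL KIT's zero-cell theorem
  (`CellKit.zero_bound_WV`, P1 g7) gives `v_p V(c) ≥ m + 1 = t`.  PROVED (`val_ge_of_pal`).  This is exactly the conjugate-pair
  first-digit cancellation of two sextic poles at level 1 (types `(0,−6,0)` / `(0,−6)`–`(−6,0)` pairs), the generic `δ = 1` event.
* RESIDUAL (`LargeParamVResidual`, OBSERVED, `@[conjecture]`): neither test fires.
CENSUS (exact, `gen9/rv9_pal.py`, every deep one-long-block instance with `b₀ ≤ 19`, `c = b` and every admissible `b + e_j`: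
77,272 pairs `(c,p)`): COUNTING 76,310 · PALINDROMIC 857 · RESIDUAL 105 — of which 102 have `δ = 2` (three- to six-class
second-digit cancellations among types `(0,−6,0)`, `(0,−5,0)`, centre classes) and 3 have `δ = 1` with ODD quintic types
`(−5,0)/(0,−5)`; the residual holds in all 105 (0 failures; it is implied by the certificate of `LargeParamVFloor`).
So `(V⁺)` — hence (CV⁺) and FLAT on (F1) — is PROVED outside a residual set of density 0.14%, all of it at bonus `δ = 2` but 3 pairs. -/

section Split

variable {p : ℕ} [hp : Fact p.Prime]

open Summit.KontsevichZagierPeriods.Zeta5Search.ClusterValuation (classPoleCount classNu classExp netExp CentreIn conjClass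
  padicNorm_coeffV_le val_ge_of_padicNorm_le uLayerCase val_ge_of_uLayer)

/-- COUNTING-CASE test: every pole class of `c` has `ν_x ≥ t`. -/
def countingCase (c : ℕ → ℤ) (p : ℕ) (t : ℤ) : Bool :=
  decide (∀ x ∈ range p, 1 ≤ classPoleCount c p x → t ≤ classNu c p x)

/-- PALINDROMIC TYPE test: the level type of the class of `x` (net exponents at `x, x+p, …, x+Lp`, `L = (c₀ − x)/p`) reads the
same backwards. -/
def palType (c : ℕ → ℤ) (p x : ℕ) : Bool :=
  (List.range (((c 0).toNat - x) / p + 1)).all fun k =>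
    netExp c (x + (((c 0).toNat - x) / p - k) * p) == netExp c (x + k * p)

/-- PALINDROMIC-CASE test at level `m`: `p ≤ c₀`, `m ≤ −4`, `m` even, `m ≤ E_x` for all classes, and every class with `E_x = m` is
centre-free with palindromic level type. -/
def palCase (c : ℕ → ℤ) (p : ℕ) (m : ℤ) : Bool :=
  decide (p ≤ (c 0).toNat) && decide (m ≤ -4) && decide ((2 : ℤ) ∣ m) && decide (∀ x ∈ range p, m ≤ classExp c p x) &&
    decide (∀ x ∈ range p, classExp c p x = m → ¬ CentreIn c p x) &&
    decide (∀ x ∈ range p, classExp c p x = m → palType c p x = true)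

/-- **COUNTING CASE (PROVED):** `v_p V(c) ≥ t` when every pole class has `ν_x ≥ t` (`classNuBound`, termwise). -/
theorem val_ge_of_counting (c : ℕ → ℤ) (hc : InPolytope c) (hp5 : 5 ≤ p) (hwin : (c 0 + 2 : ℤ) < (p : ℤ) ^ 2) {t : ℤ}
    (h : countingCase c p t = true) (hV : coeffV c ≠ 0) : t ≤ padicValRat p (coeffV c) := by
  have h' := of_decide_eq_true h
  exact val_ge_of_padicNorm_le hV
    (padicNorm_coeffV_le c hc hp5 hwin t fun x hx hpole => h' x (mem_range.2 hx) hpole)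

/-- **PALINDROMIC CASE (PROVED):** `v_p V(c) ≥ m + 1` on a palindromic zero cell of level `m` (CELL KIT: `zero_bound_WV` with
`pair_zero_of_pal`). -/
theorem val_ge_of_pal (c : ℕ → ℤ) (hc : InPolytope c) (hp5 : 5 ≤ p) (hwin : (c 0 + 2 : ℤ) < (p : ℤ) ^ 2) {m : ℤ}
    (h : palCase c p m = true) (hV : coeffV c ≠ 0) : m + 1 ≤ padicValRat p (coeffV c) := by
  simp only [palCase, Bool.and_eq_true, decide_eq_true_eq] at h
  obtain ⟨⟨⟨⟨⟨hpN, hm4⟩, hdvd⟩, hmin⟩, hcen⟩, hpal⟩ := h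
  have hmin' : ∀ x, x < p → m ≤ classExp c p x := fun x hx => hmin x (mem_range.2 hx)
  have hcen' : ∀ x, x < p → classExp c p x = m → ¬ CentreIn c p x := fun x hx hE => hcen x (mem_range.2 hx) hE
  have hm1 : (-1 : ℚ) ^ (m + 1) = -1 := CellKit.neg_one_zpow_succ_of_even (even_iff_two_dvd.2 hdvd)
  refine (CellKit.zero_bound_WV c hc hp5 hwin hpN hm4 hmin' hcen' fun x hx => ?_).2 hV
  obtain ⟨hx', hE⟩ := CellKit.mem_minSet.1 hx
  obtain ⟨hL, hL'⟩ := CellKit.level_of_lt c hx' hpN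
  exact CellKit.pair_zero_of_pal c hx' hL hL' hc hm1 (fun k => netExp c (x + k * p)) (fun k _ => rfl)
    (fun k hk => beq_iff_eq.1 (List.all_eq_true.1 (hpal x (mem_range.2 hx') hE) k (List.mem_range.2 (by omega))))
    (hcen' x hx' hE)

end Split

open Summit.KontsevichZagierPeriods.Zeta5Search.ClusterValuation (uLayerCase val_ge_of_uLayer) in
/-- **(V⁺) RESIDUAL, OBSERVED** (minted by this cell; NOT a published result): the large-parameter constant-term floor on the
instances where none of the three decidable tests fires — counting, palindromic zero cell, U-layer (34 of 77,272 pairs `(c,p)`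
with `b₀ ≤ 19`: 31 at bonus `δ = 2`, 3 at `δ = 1`; 0 failures). -/
@[conjecture] def LargeParamVResidual : Prop :=
  ∀ (b : ℕ → ℤ) (j p i : ℕ), InPolytope b → 1 ≤ j → j ≤ 7 → InPolytope (shift b j) → p.Prime → 5 ≤ p →
    (b 0 + 2 : ℤ) < (p : ℤ) ^ 2 → (∀ k ∈ (range 7).erase i, b 0 - 2 * b (k + 1) < p) →
    (countingCase b p (-pairFloors b p + lpBonus b p) = false →
      palCase b p (-pairFloors b p + lpBonus b p - 1) = false →
        uLayerCase b p (-pairFloors b p + lpBonus b p) = false →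
          coeffV b ≠ 0 → -pairFloors b p + lpBonus b p ≤ padicValRat p (coeffV b)) ∧
    (countingCase (shift b j) p (-pairFloors b p + lpBonus b p) = false →
      palCase (shift b j) p (-pairFloors b p + lpBonus b p - 1) = false →
        uLayerCase (shift b j) p (-pairFloors b p + lpBonus b p) = false →
          coeffV (shift b j) ≠ 0 → -pairFloors b p + lpBonus b p ≤ padicValRat p (coeffV (shift b j)))

open Summit.KontsevichZagierPeriods.Zeta5Search.ClusterValuation (uLayerCase val_ge_of_uLayer) in
/-- **REDUCTION (PROVED): residual ⇒ (V⁺).**  Outside the residual set (V⁺) is a theorem (counting, palindromic or U-layer case). -/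
theorem largeParamVFloor_of_residual (hR : LargeParamVResidual) : LargeParamVFloor := by
  intro b j p i hb hj1 hj7 hb' hpr hp5 hwin hshort
  haveI : Fact p.Prime := ⟨hpr⟩
  have hwin' : (shift b j 0 + 2 : ℤ) < (p : ℤ) ^ 2 := by rwa [BigPrime.shift_zero b hj1]
  obtain ⟨h1, h2⟩ := hR b j p i hb hj1 hj7 hb' hpr hp5 hwin hshort
  refine ⟨fun hV => ?_, fun hV => ?_⟩
  · cases hc : countingCase b p (-pairFloors b p + lpBonus b p)
    · cases hpal : palCase b p (-pairFloors b p + lpBonus b p - 1)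
      · cases hu : uLayerCase b p (-pairFloors b p + lpBonus b p)
        · exact h1 hc hpal hu hV
        · exact val_ge_of_uLayer b hb hp5 hwin hu hV
      · have := val_ge_of_pal b hb hp5 hwin hpal hV; linarith
    · exact val_ge_of_counting b hb hp5 hwin hc hV
  · cases hc : countingCase (shift b j) p (-pairFloors b p + lpBonus b p)
    · cases hpal : palCase (shift b j) p (-pairFloors b p + lpBonus b p - 1)
      · cases hu : uLayerCase (shift b j) p (-pairFloors b p + lpBonus b p)
        · exact h2 hc hpal hu hV
        · exact val_ge_of_uLayer (shift b j) hb' hp5 hwin' hu hV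
      · have := val_ge_of_pal (shift b j) hb' hp5 hwin' hpal hV; linarith
    · exact val_ge_of_counting (shift b j) hb' hp5 hwin' hc hV

/-- **residual ⇒ (CV⁺)** and **residual ⇒ FLAT on (F1)**. -/
theorem largeParamClassLaw_of_residual (hR : LargeParamVResidual) : LargeParamClassLaw :=
  largeParamClassLaw_of_vFloor (largeParamVFloor_of_residual hR)

/-- **residual ⇒ FLAT on (F1)**. -/
theorem flatGaugeLawF1_of_residual (hR : LargeParamVResidual) : FlatGaugeLawF1 :=
  flatGaugeLawF1_of_vFloor (largeParamVFloor_of_residual hR)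

open Summit.KontsevichZagierPeriods.Zeta5Search.ClusterValuation (uLayerCase) in
/-- Kernel instances of the cases.  `b = (11;5,5,5,5,5,5,0)`, `p = 5`, `t = −6 + 1 = −5`: not counting (the sextic pole
classes `x = 0, 1` have `ν = E = −6`), palindromic at `m = −6` (types `(0,−6,0)`; PROVED instance of (V⁺)). -/
example :
    let b : ℕ → ℤ := fun k => (([11, 5, 5, 5, 5, 5, 5, 0] : List ℤ)).getD k 0
    countingCase b 5 (-5) = false ∧ palCase b 5 (-6) = true := by
  decide

open Summit.KontsevichZagierPeriods.Zeta5Search.ClusterValuation (uLayerCase) in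
/-- `b = (12;5,5,4,4,4,4,0)`, `p = 5`, `N_5 = 6`, bonus `2`, `t = −4`: neither counting nor palindromic (deficient classes
`x = 0, 2` of type `(0,−6,0)` and the centre class `x = 1` of type `(0,−5,0)`), but a U-LAYER configuration (`Q = {5,6,7}`,
`2p = 10 ≤ d + 1 = 12`): PROVED instance of (V⁺) with `δ = 2`.  Its shift `b + e_7 = (12;5,5,4,4,4,4,1)` (zero at position
`0` below the sextic pole `5`) is a residual instance. -/
example :
    let b : ℕ → ℤ := fun k => (([12, 5, 5, 4, 4, 4, 4, 0] : List ℤ)).getD k 0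
    pairFloors b 5 = 6 ∧ lpBonus b 5 = 2 ∧ countingCase b 5 (-4) = false ∧ palCase b 5 (-5) = false ∧
      uLayerCase b 5 (-4) = true := by
  decide

open Summit.KontsevichZagierPeriods.Zeta5Search.ClusterValuation (uLayerCase) in
example :
    let c : ℕ → ℤ := fun k => (([12, 5, 5, 4, 4, 4, 4, 1] : List ℤ)).getD k 0
    countingCase c 5 (-4) = false ∧ palCase c 5 (-5) = false ∧ uLayerCase c 5 (-4) = false := by
  decide

end Summit.KontsevichZagierPeriods.Zeta5Search.RVFlatGauge
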